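import Mathlib
import Summits.MatrixMultiplication.MatrixMultiplication.Theorems.SnSubsetDichotomyPolynomialSlackPolylogPower

/-!
# `SnSubsetDichotomy.PolynomialSlack`, line `transport-split-hull` — stub `eventually_sharp_smallB`

Crux `Summit.MatrixMultiplication.MatrixMultiplication.Theses.SnSubsetDichotomy.PolynomialSlack`
(item `stmt-MatrixMultiplication-8306`), level-one programme ("5/8 step"), registered stub
`eventually_sharp_smallB` (E1c) of `Cruxes/PolynomialSlack/Lines/transport-split-hull.lean`:
the TWO-DENSE smallness condition.  Pure real analysis.

With `G = 1 + log n`, `P = 10³⁴ G¹⁸`, the scale `M = P F² / (n - 1)` and `Λ = 1200 G²`, for every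
`C₁ < 2/3` there is `n₀` such that for all `n ≥ n₀` and all `0 < F ≤ 8 n^{C₁}`,
`F (√6/√(n(n-1)) + 30 √(G · 6G / M)/√(n-1)) + 256 Λ² n M⁴/((n-1) F²) ≤ 1/(5 · 10¹⁴ G⁸)`.

Proof.  Write `x = n ≥ 2`, `R = 1/(5 · 10¹⁴ G⁸)`.
* Term B is exact: `G · 6G / M = (√6 √(x-1) / (10¹⁷ G⁸ F))²`, so
  `F · 30 √(…)/√(x-1) = 30 √6/(10¹⁷ G⁸) ≤ 90/(10¹⁷ G⁸) ≤ R/2` (`√6 ≤ 3`).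
* Term A: `√(x(x-1)) ≥ x - 1 ≥ x/2`, so `F √6/√(x(x-1)) ≤ 48 x^{C₁}/x ≤ R/4` as soon as
  `960 · 10¹⁴ G⁸ x^{C₁} ≤ x` (master lemma `eventually_log_pow_mul_rpow_le`, gap `1 - C₁ > 0`).
* Term D: `256 Λ² x M⁴/((x-1)F²) = 256 · 1200² · 10¹³⁶ G⁷⁶ x F⁶/(x-1)⁵`, and with `F⁶ ≤ 8⁶ x^{6C₁}`,
  `(x-1)⁵ ≥ x⁵/32` this is `≤ R/4` as soon as `c G⁸⁴ x^{6 C₁ + 1} ≤ x⁵`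
  (master lemma, gap `5 - (6 C₁ + 1) > 0` iff `C₁ < 2/3`).
The threshold is the maximum of `2` and the two master thresholds.
-/

namespace Summit.MatrixMultiplication.MatrixMultiplication.Theorems.PolynomialSlack

-- `Summit.<Summit>.<Problem>` is the tree's mandated summit-side namespace; for this
-- single-conjunct summit the two coincide, so the file silences `dupNamespace`.
set_option linter.dupNamespace false

/-- `√6 ≤ 3` (as `6 ≤ 3²`). [folklore] -/
theorem sharpSmallB_sqrt_six_le : Real.sqrt 6 ≤ 3 := by
  -- adapted from `smallErrors_term₁_le`
  calc Real.sqrt 6 ≤ Real.sqrt (3 ^ 2) := Real.sqrt_le_sqrt (by norm_num)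
    _ = 3 := Real.sqrt_sq (by norm_num)

/-- Term A: if `F ≤ 8 P` and `960 · 10¹⁴ · G⁸ · P ≤ x` with `x ≥ 2`, then
`F √6 / √(x (x - 1)) ≤ 1 / (4 · (5 · 10¹⁴ G⁸))` (`√6 ≤ 3`, `√(x(x-1)) ≥ x - 1 ≥ x / 2`).
[folklore] -/
theorem sharpSmallB_termA_le {x F P G : ℝ} (hx : 2 ≤ x) (hP : 0 ≤ P)
    (hFP : F ≤ 8 * P) (hG : 0 < G) (h1 : 960 * 10 ^ 14 * G ^ 8 * P ≤ x) :
    F * (Real.sqrt 6 / Real.sqrt (x * (x - 1))) ≤ 1 / (4 * (5 * 10 ^ 14 * G ^ 8)) := by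
  have hx0 : 0 < x := by linarith
  have hx1 : 0 < x - 1 := by linarith
  have h6 := sharpSmallB_sqrt_six_le
  have hden : x - 1 ≤ Real.sqrt (x * (x - 1)) := by
    calc x - 1 = Real.sqrt ((x - 1) ^ 2) := (Real.sqrt_sq hx1.le).symm
      _ ≤ Real.sqrt (x * (x - 1)) := Real.sqrt_le_sqrt (by nlinarith)
  have hpos : 0 < Real.sqrt (x * (x - 1)) := Real.sqrt_pos.2 (mul_pos hx0 hx1)
  rw [mul_div_assoc', div_le_div_iff₀ hpos (by positivity)]
  calc F * Real.sqrt 6 * (4 * (5 * 10 ^ 14 * G ^ 8))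
      ≤ 8 * P * 3 * (4 * (5 * 10 ^ 14 * G ^ 8)) := by gcongr
    _ = 960 * 10 ^ 14 * G ^ 8 * P / 2 := by ring
    _ ≤ x / 2 := by linarith
    _ ≤ 1 * Real.sqrt (x * (x - 1)) := by linarith

/-- Term B is exact: `F · 30 √(G · 6G / (10³⁴ G¹⁸ F² / (x - 1))) / √(x - 1) = 30 √6 / (10¹⁷ G⁸)`
for `x > 1`, `F, G > 0` (the radicand is the square `(√6 √(x-1) / (10¹⁷ G⁸ F))²`). [folklore] -/
theorem sharpSmallB_termB_eq {x F G : ℝ} (hx : 2 ≤ x) (hF : 0 < F) (hG : 0 < G) :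
    F * (30 * Real.sqrt (G * (6 * G) / (10 ^ 34 * G ^ 18 * F ^ 2 / (x - 1))) /
        Real.sqrt (x - 1)) =
      30 * Real.sqrt 6 / (10 ^ 17 * G ^ 8) := by
  have hx1 : 0 < x - 1 := by linarith
  have hx1' : x - 1 ≠ 0 := hx1.ne'
  have hF' : F ≠ 0 := hF.ne'
  have hG' : G ≠ 0 := hG.ne'
  have hrad : G * (6 * G) / (10 ^ 34 * G ^ 18 * F ^ 2 / (x - 1)) =
      (Real.sqrt 6 * Real.sqrt (x - 1) / (10 ^ 17 * G ^ 8 * F)) ^ 2 := by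
    rw [div_pow, mul_pow, Real.sq_sqrt (by norm_num : (0 : ℝ) ≤ 6), Real.sq_sqrt hx1.le]
    field_simp
  have hs1 : 0 < Real.sqrt (x - 1) := Real.sqrt_pos.2 hx1
  have hs1' : Real.sqrt (x - 1) ≠ 0 := hs1.ne'
  rw [hrad, Real.sqrt_sq (by positivity)]
  field_simp

/-- Term B bound: `30 √6 / (10¹⁷ G⁸) ≤ 1 / (2 · (5 · 10¹⁴ G⁸))` (`30 √6 ≤ 90 ≤ 100`). [folklore] -/
theorem sharpSmallB_termB_le {G : ℝ} (hG : 0 < G) :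
    30 * Real.sqrt 6 / (10 ^ 17 * G ^ 8) ≤ 1 / (2 * (5 * 10 ^ 14 * G ^ 8)) := by
  have h6 := sharpSmallB_sqrt_six_le
  have hG8 : 0 < G ^ 8 := by positivity
  rw [div_le_div_iff₀ (by positivity) (by positivity)]
  calc 30 * Real.sqrt 6 * (2 * (5 * 10 ^ 14 * G ^ 8))
      ≤ 30 * 3 * (2 * (5 * 10 ^ 14 * G ^ 8)) := by gcongr
    _ = 9 * (10 ^ 16 * G ^ 8) := by ring
    _ ≤ 10 * (10 ^ 16 * G ^ 8) := by gcongr; norm_num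
    _ = 1 * (10 ^ 17 * G ^ 8) := by ring

/-- Term D: if `F ≤ 8 P`, `F > 0` and `256 · 1200² · 20 · 10¹⁵⁰ · 8⁶ · 32 · G⁸⁴ · (P⁶ x) ≤ x⁵`
with `x ≥ 2`, then `256 (1200 G²)² x (10³⁴ G¹⁸ F²/(x-1))⁴ / ((x-1) F²) ≤ 1 / (4 · (5 · 10¹⁴ G⁸))`
(the left side equals `256 · 1200² · 10¹³⁶ G⁷⁶ x F⁶ / (x-1)⁵`, `F⁶ ≤ 8⁶ P⁶`, `x⁵ ≤ 32 (x-1)⁵`).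
[folklore] -/
theorem sharpSmallB_termD_le {x F P G : ℝ} (hx : 2 ≤ x) (hF : 0 < F)
    (hFP : F ≤ 8 * P) (hG : 0 < G)
    (h2 : 256 * 1200 ^ 2 * 20 * 10 ^ 150 * 8 ^ 6 * 32 * G ^ 84 * (P ^ 6 * x) ≤ x ^ 5) :
    256 * (1200 * G ^ 2) ^ 2 * x * (10 ^ 34 * G ^ 18 * F ^ 2 / (x - 1)) ^ 4 /
        ((x - 1) * F ^ 2) ≤
      1 / (4 * (5 * 10 ^ 14 * G ^ 8)) := by
  have hx0 : 0 < x := by linarith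
  have hx1 : 0 < x - 1 := by linarith
  have hx1' : x - 1 ≠ 0 := hx1.ne'
  have hF' : F ≠ 0 := hF.ne'
  have key : 256 * (1200 * G ^ 2) ^ 2 * x * (10 ^ 34 * G ^ 18 * F ^ 2 / (x - 1)) ^ 4 /
        ((x - 1) * F ^ 2) =
      256 * 1200 ^ 2 * 10 ^ 136 * G ^ 76 * x * F ^ 6 / (x - 1) ^ 5 := by
    field_simp
  have hF6 : F ^ 6 ≤ (8 * P) ^ 6 := pow_le_pow_left₀ hF.le hFP 6
  have hx5 : x ^ 5 ≤ 32 * (x - 1) ^ 5 := by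
    have h2x : x ≤ 2 * (x - 1) := by linarith
    calc x ^ 5 ≤ (2 * (x - 1)) ^ 5 := pow_le_pow_left₀ hx0.le h2x 5
      _ = 32 * (x - 1) ^ 5 := by ring
  rw [key, div_le_div_iff₀ (by positivity) (by positivity)]
  calc 256 * 1200 ^ 2 * 10 ^ 136 * G ^ 76 * x * F ^ 6 * (4 * (5 * 10 ^ 14 * G ^ 8))
      ≤ 256 * 1200 ^ 2 * 10 ^ 136 * G ^ 76 * x * (8 * P) ^ 6 * (4 * (5 * 10 ^ 14 * G ^ 8)) := by
        gcongr
    _ = 256 * 1200 ^ 2 * 20 * 10 ^ 150 * 8 ^ 6 * 32 * G ^ 84 * (P ^ 6 * x) / 32 := by ring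
    _ ≤ x ^ 5 / 32 := by gcongr
    _ ≤ 1 * (x - 1) ^ 5 := by linarith

/-- Real-variable assembly: from the two instances of the master polylog-versus-power comparison
(in the raw `Real.rpow` form in which `eventually_log_pow_mul_rpow_le` delivers them) at a real
`x ≥ 2` and any `0 < F ≤ 8 x^{C₁}`, the two-dense smallness inequality follows
(terms A and D are each at most a quarter, term B at most half of the right-hand side).
[folklore] -/
theorem sharpSmallB_of_master {x C₁ F : ℝ} (hx : 2 ≤ x) (hF : 0 < F) (hFle : F ≤ 8 * x ^ C₁)
    (h1 : 960 * 10 ^ 14 * (1 + Real.log x) ^ 8 * x ^ C₁ ≤ x ^ (1 : ℝ))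
    (h2 : 256 * 1200 ^ 2 * 20 * 10 ^ 150 * 8 ^ 6 * 32 * (1 + Real.log x) ^ 84 *
        x ^ (C₁ * 6 + 1) ≤ x ^ (5 : ℝ)) :
    F * (Real.sqrt 6 / Real.sqrt (x * (x - 1)) +
          30 * Real.sqrt ((1 + Real.log x) * (6 * (1 + Real.log x)) /
            (10 ^ 34 * (1 + Real.log x) ^ 18 * F ^ 2 / (x - 1))) / Real.sqrt (x - 1)) +
        256 * (1200 * (1 + Real.log x) ^ 2) ^ 2 * x *
          (10 ^ 34 * (1 + Real.log x) ^ 18 * F ^ 2 / (x - 1)) ^ 4 / ((x - 1) * F ^ 2) ≤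
      1 / (5 * 10 ^ 14 * (1 + Real.log x) ^ 8) := by
  have hx0 : 0 < x := by linarith
  have hG : 0 < 1 + Real.log x := by
    have := Real.log_nonneg (by linarith : (1 : ℝ) ≤ x)
    linarith
  have hP : 0 ≤ x ^ C₁ := Real.rpow_nonneg hx0.le C₁
  -- bring the master inequalities to monomial form
  rw [Real.rpow_one] at h1
  rw [Real.rpow_add hx0, Real.rpow_one, Real.rpow_mul hx0.le, Real.rpow_ofNat,
    Real.rpow_ofNat] at h2
  have eA := sharpSmallB_termA_le hx hP hFle hG h1
  have eB := sharpSmallB_termB_eq hx hF hG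
  have eB' := sharpSmallB_termB_le hG
  have eD := sharpSmallB_termD_le hx hF hFle hG h2
  have hr : ∀ r : ℝ, 1 / (4 * r) + 1 / (2 * r) + 1 / (4 * r) = 1 / r := by
    intro r
    ring
  rw [mul_add, eB]
  exact (add_le_add (add_le_add eA eB') eD).trans_eq (hr _)

/-- **Two-dense smallness, eventually** (registered stub `eventually_sharp_smallB`, E1c, of line
`transport-split-hull`): for `C₁ < 2/3` there is `n₀` such that for all `n ≥ n₀` and all
`0 < F ≤ 8 n^{C₁}`, with `G = 1 + log n` and `M = 10³⁴ G¹⁸ F² / (n - 1)`,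
`F (√6/√(n(n-1)) + 30 √(G · 6G / M)/√(n-1)) + 256 (1200 G²)² n M⁴/((n-1) F²) ≤ 1/(5 · 10¹⁴ G⁸)`
(two instances of `eventually_log_pow_mul_rpow_le`, assembled by `sharpSmallB_of_master`).
[folklore] -/
theorem eventually_sharp_smallB (C₁ : ℝ) (hC₁ : C₁ < 2 / 3) :
    ∃ n₀ : ℕ, ∀ n : ℕ, n₀ ≤ n → ∀ F : ℝ, 0 < F → F ≤ 8 * (n : ℝ) ^ C₁ →
      F * (Real.sqrt 6 / Real.sqrt ((n : ℝ) * ((n : ℝ) - 1)) +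
            30 * Real.sqrt ((1 + Real.log n) * (6 * (1 + Real.log n)) /
              (10 ^ 34 * (1 + Real.log n) ^ 18 * F ^ 2 / ((n : ℝ) - 1))) / Real.sqrt ((n : ℝ) - 1)) +
          256 * (1200 * (1 + Real.log n) ^ 2) ^ 2 * n *
            (10 ^ 34 * (1 + Real.log n) ^ 18 * F ^ 2 / ((n : ℝ) - 1)) ^ 4 / (((n : ℝ) - 1) * F ^ 2) ≤
        1 / (5 * 10 ^ 14 * (1 + Real.log n) ^ 8) := by
  obtain ⟨N₁, hN₁⟩ :=
    eventually_log_pow_mul_rpow_le 8 C₁ 1 (960 * 10 ^ 14) (by linarith) (by norm_num)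
  obtain ⟨N₂, hN₂⟩ :=
    eventually_log_pow_mul_rpow_le 84 (C₁ * 6 + 1) 5
      (256 * 1200 ^ 2 * 20 * 10 ^ 150 * 8 ^ 6 * 32) (by linarith) (by norm_num)
  refine ⟨max 2 (max N₁ N₂), fun n hn F hF hFle => ?_⟩
  simp only [max_le_iff] at hn
  obtain ⟨h2, hn1, hn2⟩ := hn
  have hx : (2 : ℝ) ≤ n := by exact_mod_cast h2
  exact sharpSmallB_of_master hx hF hFle (hN₁ n hn1) (hN₂ n hn2)

end Summit.MatrixMultiplication.MatrixMultiplication.Theorems.PolynomialSlack
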